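import Summits.Ventures.DiscreteObjects.PP12.FanoFiveOrderFiveKernel
import Summits.Ventures.DiscreteObjects.PP12.OrderElevenIff

/-!
# PP(12): the collineation census after the order-5 kernel theorem — corollaries (kernel)
Framing: lottery ticket; floor = certified bounds/negative ranges.

Cell pub-namedobj (venture DiscreteObjects), target (M), designs gen 18. With `noOrderFiveOrder12_holds : NoOrderFiveOrder12` (`FanoFiveOrderFiveKernel`) the
order-5 hypothesis disappears from the census statements: (1) the `{2,3}`-group statement is now equivalent to the two remaining prime cells `p = 11, 13` in
their exact finite forms (`twoThreeGroup_iff_eleven_thirteen`, from designs g16's `twoThreeGroup_iff_arrays`); (2) the rigid endgame loses its order-5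
hypothesis (`card_collineationGroup_eq_one_v17`, from designs g16's v13: every remaining hypothesis is a typed finite array / orbit-matrix statement of the
cells `p = 2, 3, 11, 13`, decided EMPTY outside the kernel or in print, none asserted here). Nothing else is asserted. No `sorry`, no new axioms.
-/

namespace Summit.Ventures.DiscreteObjects.PP12

open Literature.Combinatorics.Designs in
/-- **After the kernel theorem for `p = 5`: the collineation group of a projective plane of order 12 is a `{2,3}`-group iff the finite statements of the
cells `p = 11` and `p = 13` hold.** -/
theorem twoThreeGroup_iff_eleven_thirteen : CollineationGroupIsTwoThreeGroup ↔ NoCollineationOfOrderEleven ∧ NoLiftData13 := by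
  rw [twoThreeGroup_iff_arrays]
  exact ⟨fun h => h.2, fun h => ⟨noOrderFiveOrder12_holds, h⟩⟩

/-- the matrix-level order-5 statement of designs g15, now a theorem (via the coding statement decided in the kernel) -/
theorem noFanoFiveIncMatrix_holds : NoFanoFiveIncMatrix :=
  noFanoFiveIncMatrix_of_noECode (FanoFive.noECode_of_noWordCode FanoFive.Kernel.noWordCode)

open Configuration Literature.Combinatorics.Designs Summit.Ventures.DiscreteObjects.STD in
/-- **Rigid endgame, v17 (order-5 hypothesis DISCHARGED by the kernel):** the typed finite statements of the cells `p = 2, 3, 11, 13` force every collineation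
group of a projective plane of order 12 to be trivial. -/
theorem card_collineationGroup_eq_one_v17 (h2 : NoLiftableSTD2_12_6) (h3E : NoLiftableSTD3_12_4)
    (h4 : NoFlagOrbitMatrix 4) (h3 : NoFlagOrbitMatrix 3) (h7 : NoFlagSevenOrbitMatrix) (h10 : NoFlagTenOrbitMatrix)
    (h11 : NoCollineationOfOrderEleven) (h13 : NoLiftData13)
    (P L : Type) [Membership P L] [Fintype P] [Fintype L] [ProjectivePlane P L] (h12 : ProjectivePlane.order P L = 12)
    (G : Type) [Group G] [Fintype G] [MulAction G P] [MulAction G L] (hG : IsCollineationGroup G P L) :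
    Fintype.card G = 1 :=
  card_collineationGroup_eq_one_v13 h2 h3E h4 h3 h7 h10 noFanoFiveIncMatrix_holds h11 h13 P L h12 G hG

end Summit.Ventures.DiscreteObjects.PP12
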